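import Summits.BirchSwinnertonDyer.Rank1Residual.Additive.CyclotomicThreeRankOneCardIdentity
import Literature.NumberTheory.EllipticCurves.Wuthrich2014.RankOneEngineOddPrimeProofs
import Literature.NumberTheory.EllipticCurves.IwasawaLeadingTermProofs
import HarnessLib

/-!
# Ranks `(0,1)` at `p = 3` over `K = ℚ(ζ₃)` — preparatory lemmas for the core theorem of line V17
# (`XGordRankZeroOneCyclotomicThree.lean`): the two analytic sides over `ℚ` and Milne in valuations

HONEST FRAMING (cell `b2b-bsdres`, run/shared/lean/b2b/bsd-rank1-residual/, verbatim in every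
file): the goal of the cell is to DELETE the COMBINATION-SHAPED residual classes of the
Birch–Swinnerton-Dyer formula for ALL analytic-rank `≤ 1` elliptic curves over `ℚ` — "full BSD
formula for every rank `≤ 1` curve in class `C`" assembled STRICTLY from published theorems — so
that the rank-`≤ 1` remainder becomes exactly the CONSTRUCTION-SHAPED classes, which are TYPED
(missing-input `Prop`s), NOT attempted. This is not "finishing BSD". Seat additive-p4, gen 7
(research route on X3/X4); labels UNCHANGED; nothing is booked here.

Theorems only (no `def`, no `sorry`, no named fact).
* `rankOne_shaAn_data` — the analytic side of the rank-ONE curve `V`: Perrin-Riou's comparison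
  (tree engine `Wuthrich2014.exists_rat_leadingTerms_of_analyticRank_eq_one_odd`, from the named fact
  `perrinRiou_rankOne_leadingTerms_odd`) gives ONE rational `q ≠ 0` with
  `#Ш_an(V) = q ϖ #V(ℚ)_tors² / ∏ c(V)` and `[T¹]L₃(f,α) · log₃γ = q (1 − α⁻¹)² Reg₃(V)`;
* `twistNegThree_shaAn_data` — the analytic side of the rank-ZERO additive twist `W = C • V^{(−3)}`
  (odd Birch + Pal, tree theorem `entireLFunction_one_eq_of_twist_neg`): `#Ш_an(W) = t_W #W(ℚ)²/∏ c(W)`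
  with `ord₃ t_W = ord₃ (ϖ' S⁻) − ord₃ |u_C|`, `S⁻ = ∑(a/3)[a/3]⁻_f`, `ϖ' S⁻ ≠ 0` (verbatim the block of
  lines V14–V16);
* `padicVal_card_identity_rankZeroOne` — Milne's rank-`(0,1)` identity
  (`card_identity_baseChange_rankZeroOne`) in `3`-adic valuations.
-/

noncomputable section

open scoped Classical MatrixGroups ModularForm

open CongruenceSubgroup WeierstrassCurve NumberField
  Literature.NumberTheory.EllipticCurves Literature.NumberTheory.EllipticCurves.ModularForms
  Literature.NumberTheory.EllipticCurves.Rank1Residual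

namespace Summit.BirchSwinnertonDyer.Rank1Residual.Additive

section AnalyticSides

variable (V : WeierstrassCurve ℚ) [V.IsElliptic] [V.IsGloballyMinimal]
  (W : WeierstrassCurve ℚ) [W.IsElliptic] [W.IsGloballyMinimal]

omit [W.IsElliptic] [W.IsGloballyMinimal] in
/-- **Analytic side of the rank-one curve.** For `V` globally minimal, good ordinary at the odd prime
`p`, of analytic rank `1`, `f` its newform with `ϖ Ω_V = Ω⁺_f`, and `Dh` THE canonical `p`-adic height:
ONE rational `q ≠ 0` with `#Ш_an(V) = q ϖ #V(ℚ)_tors²/∏ c(V)` and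
`[T¹]L_p(f,α)·log_p γ = q (1 − α⁻¹)² Reg_p(V, Dh)` (Perrin-Riou 1987 via the tree's rank-one engine).
[cite: PerrinRiou1987, §1.4 Cor. 1.8] [cite: SteinWuthrich2013, §9] -/
theorem rankOne_shaAn_data (hPR : perrinRiou_rankOne_leadingTerms_odd)
    (hGZK : rank_eq_analyticRank_of_analyticRank_le_one) (p : ℕ) [Fact p.Prime] (hp : p ≠ 2)
    (hord : IsOrdinaryAt V p) (hrV : V.analyticRank = 1)
    {N : ℕ} [NeZero N] {f : CuspForm (Gamma0 N) 2} (hf : IsNewformOf V f)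
    (ϖ : ℚ) (hϖ : (ϖ : ℝ) * V.realPeriodRat = plusPeriod f)
    (Dh : PAdicHeightData V p) (hDh : Dh.IsCanonical) :
    ∃ q : ℚ, q ≠ 0 ∧ ϖ ≠ 0 ∧
      shaAn V = ((q * ϖ * (V.torsionOrder : ℚ) ^ 2 / (V.tamagawaProduct : ℚ) : ℚ) : ℂ) ∧
      PowerSeries.coeff 1 (padicLFunction f (unitRoot V p : ℚ_[p])) * padicLog p (cyclotomicGenerator p) =
        (q : ℚ_[p]) * (1 - (unitRoot V p : ℚ_[p])⁻¹) ^ 2 * padicRegulator Dh := by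
  obtain ⟨q, hq0, hlead, hpad⟩ :=
    Wuthrich2014.exists_rat_leadingTerms_of_analyticRank_eq_one_odd hPR hGZK V p hp hord hrV Dh hDh f hf
  have hϖ0 : ϖ ≠ 0 := by
    rintro rfl
    have hper : 0 < plusPeriod f := IsNewform0.plusPeriod_pos_holds hf.1 hf.coeffField_eq_bot
    rw [← hϖ, Rat.cast_zero, zero_mul] at hper
    exact lt_irrefl _ hper
  refine ⟨q, hq0, hϖ0, ?_, hpad⟩
  have htamV : (V.tamagawaProduct : ℚ) ≠ 0 := by exact_mod_cast V.tamagawaProduct_pos_holds.ne'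
  have hΩC : (V.realPeriodRat : ℂ) ≠ 0 := by exact_mod_cast V.realPeriodRat_pos_holds.ne'
  have hRegC : (V.regulator : ℂ) ≠ 0 := by exact_mod_cast (regulator_pos_holds V).ne'
  have htamC : (V.tamagawaProduct : ℂ) ≠ 0 := by exact_mod_cast htamV
  have hper : (plusPeriod f : ℂ) = (ϖ : ℂ) * (V.realPeriodRat : ℂ) := by
    rw [← hϖ]; push_cast; ring
  rw [shaAn_def, hlead]
  push_cast
  rw [hper]
  field_simp

/-- **Analytic side of the rank-zero additive twist at `3`.** For `W = C • V^{(−3)}` globally minimal,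
additive at `3`, of analytic rank `0`, `f` the newform of `V` with `ϖ'|Ω⁻(V)| = Ω⁻_f`: there is a
rational `t_W ≠ 0` with `L(W,1)/Ω_W = t_W`, `#Ш_an(W) = t_W #W(ℚ)²/∏ c(W)`,
`ord₃ t_W = ord₃(ϖ' S⁻) − ord₃ |u_C|` (`S⁻ = legendreMinusSymbolSum f 3`) and `ϖ' S⁻ ≠ 0` — odd Birch +
Pal for `d = −3` (tree theorem `entireLFunction_one_eq_of_twist_neg`) and Gross–Zagier–Kolyvagin.
[cite: MazurTateTeitelbaum1986Invent, §I.8] [cite: Pal2012, Thm. 3.2] -/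
theorem twistNegThree_shaAn_data (hGZK : rank_eq_analyticRank_of_analyticRank_le_one)
    (hmod : hasEntireLFunction_rat) (C : VariableChange ℚ) (hC : C • V.quadraticTwist (-(3 : ℚ)) = W)
    (hadd : Addv W 3) (hrW : W.analyticRank = 0)
    {N : ℕ} [NeZero N] {f : CuspForm (Gamma0 N) 2} (hf : IsNewformOf V f)
    (ϖ' : ℚ) (hϖ' : (ϖ' : ℝ) * V.imaginaryPeriodRat = minusPeriod f) [Finite W.toAffine.Point] :
    ∃ tW : ℚ, tW ≠ 0 ∧ ϖ' * legendreMinusSymbolSum f 3 ≠ 0 ∧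
      shaAn W = ((tW * (Nat.card W.toAffine.Point : ℚ) ^ 2 / (W.tamagawaProduct : ℚ) : ℚ) : ℂ) ∧
      padicValRat 3 tW = padicValRat 3 (ϖ' * legendreMinusSymbolSum f 3) - padicValRat 3 |(C.u : ℚ)| := by
  have hLW : W.entireLFunction 1 ≠ 0 := (W.analyticRank_eq_zero_iff_holds (hmod W)).mp hrW
  obtain ⟨ε, hε, hLW_eq⟩ :=
    entireLFunction_one_eq_of_twist_neg 3 hmod (by norm_num) V W C hC hadd hf ϖ' hϖ'
  set S : ℚ := legendreMinusSymbolSum f 3 with hS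
  set cinf : ℕ := (W.baseChange ℝ).numRealComponents with hcinf
  set tW : ℚ := ε * (ϖ' * S) / (|(C.u : ℚ)| * (cinf : ℚ)) with htW
  have hΩW : (W.realPeriodRat : ℂ) ≠ 0 := by exact_mod_cast W.realPeriodRat_pos_holds.ne'
  have hqW' : W.entireLFunction 1 / (W.realPeriodRat : ℂ) = (tW : ℂ) := by
    rw [hLW_eq, mul_div_cancel_right₀ _ hΩW]
  obtain ⟨-, -, -, hshaW⟩ := Wuthrich2014.shaAn_eq_of_L_one_div_eq hGZK W hLW hqW'
  have hua0 : |(C.u : ℚ)| ≠ 0 := abs_ne_zero.mpr C.u.ne_zero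
  have hcinf0 : (cinf : ℚ) ≠ 0 := by
    rw [hcinf, numRealComponents]
    split_ifs <;> norm_num
  have hden0 : |(C.u : ℚ)| * (cinf : ℚ) ≠ 0 := mul_ne_zero hua0 hcinf0
  have hϖS : ϖ' * S ≠ 0 := by
    intro h0
    apply hLW
    rw [hLW_eq, htW, h0, mul_zero, zero_div, Rat.cast_zero, zero_mul]
  have hε0 : ε ≠ 0 := by rcases hε with h | h <;> rw [h] <;> norm_num
  have htW0 : tW ≠ 0 := by
    rw [htW]
    exact div_ne_zero (mul_ne_zero hε0 hϖS) hden0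
  have hvε : padicValRat 3 ε = 0 := by
    rcases hε with h | h
    · rw [h, padicValRat.one]
    · rw [h, padicValRat.neg, padicValRat.one]
  have hvtW : padicValRat 3 tW = padicValRat 3 (ϖ' * S) - padicValRat 3 |(C.u : ℚ)| := by
    rw [htW, padicValRat.div (mul_ne_zero hε0 hϖS) hden0, padicValRat.mul hε0 hϖS,
      padicValRat.mul hua0 hcinf0, hvε, padicValRat_numRealComponents_eq_zero W 3 (by norm_num)]
    ring
  exact ⟨tW, htW0, hϖS, hshaW, hvtW⟩

end AnalyticSides

section MilneVal

variable (K : Type) [Field K] [NumberField K]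
  (V : WeierstrassCurve ℚ) [V.IsElliptic] [V.IsGloballyMinimal]
  (W : WeierstrassCurve ℚ) [W.IsElliptic] [W.IsGloballyMinimal]

omit [V.IsGloballyMinimal] [W.IsGloballyMinimal] in
/-- **Milne's rank-`(0,1)` identity in `3`-adic valuations** (`p` any prime not dividing `m`, `m ∣ 2`,
so any odd `p`): from `card_identity_baseChange_rankZeroOne`,
`ord_p C(V⊗K) + ord_p #Ш(V_K) + 2 ord_p #V(ℚ)_tors + 2 ord_p #W(ℚ) =
 ord_p |u_C| + ord_p #Ш(V) + ord_p #Ш(W) + ord_p ∏c(V) + ord_p ∏c(W) + 2 ord_p #V(K)_tors`.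
[cite: Milne1972ArithmeticAV, §1 Thm. 1] -/
theorem padicVal_card_identity_rankZeroOne [IsTotallyComplex K] (h2 : Module.finrank ℚ K = 2)
    (p : ℕ) [Fact p.Prime] (hp : p ≠ 2)
    {C : VariableChange ℚ} (hC : C • V.quadraticTwist (NumberField.discr K : ℚ) = W)
    [Finite W.toAffine.Point] (hfinV : V.ShaFinite) (hfinW : W.ShaFinite) (hshaK : (V.baseChange K).ShaFinite)
    {P₀ : V.toAffine.Point} (hP₀ : IsMordellWeilBasis (fun _ : Fin 1 => P₀))
    {Q : (V.baseChange K).toAffine.Point} (hQ : IsMordellWeilBasis (fun _ : Fin 1 => Q))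
    {m : ℤ} (hm2 : m ∣ 2) {t : (V.baseChange K).toAffine.Point} (ht : IsOfFinAddOrder t)
    (hmQ : V.pointToBaseChange K P₀ = m • Q + t)
    (hWR : ((V.baseChange K).shaOrder : ℝ) * (V.baseChange K).regulator * (V.baseChange K).bsdPeriod *
        ((V.baseChange K).modifiedTamagawaProduct : ℝ) / ((V.baseChange K).torsionOrder : ℝ) ^ 2 =
      V.bsdRHS * W.bsdRHS) :
    (V.baseChange K).modifiedTamagawaProduct ≠ 0 ∧
    padicValRat p (V.baseChange K).modifiedTamagawaProduct + padicValNat p (V.baseChange K).shaOrder +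
        2 * padicValNat p V.torsionOrder + 2 * padicValNat p (Nat.card W.toAffine.Point) =
      padicValRat p |(C.u : ℚ)| + padicValNat p V.shaOrder + padicValNat p W.shaOrder +
        padicValNat p V.tamagawaProduct + padicValNat p W.tamagawaProduct +
        2 * padicValNat p (V.baseChange K).torsionOrder := by
  haveI : (V.baseChange K).IsElliptic := by rw [WeierstrassCurve.baseChange]; infer_instance
  have hcard := card_identity_baseChange_rankZeroOne K V W h2 hC hP₀ hQ ht hmQ hWR
  have hm0 : m ≠ 0 := by
    rintro rfl
    exact two_ne_zero (zero_dvd_iff.mp hm2)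
  have hmp : ¬ (p : ℤ) ∣ m := by
    intro hpm
    have h2' : (p : ℤ) ∣ 2 := dvd_trans hpm hm2
    have hp2 : (p : ℕ) ∣ 2 := by exact_mod_cast h2'
    have hle : p ≤ 2 := Nat.le_of_dvd two_pos hp2
    have hge : 2 ≤ p := (Fact.out : p.Prime).two_le
    exact hp (le_antisymm hle hge)
  have hnV0 : ((V.baseChange ℝ).numRealComponents : ℚ) ≠ 0 := by
    rw [numRealComponents]; split_ifs <;> norm_num
  have hSV0 : (V.shaOrder : ℚ) ≠ 0 := by exact_mod_cast (V.shaOrder_pos hfinV).ne'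
  have hSW0 : (W.shaOrder : ℚ) ≠ 0 := by exact_mod_cast (W.shaOrder_pos hfinW).ne'
  have hSK0 : ((V.baseChange K).shaOrder : ℚ) ≠ 0 := by exact_mod_cast ((V.baseChange K).shaOrder_pos hshaK).ne'
  have hcV0 : (V.tamagawaProduct : ℚ) ≠ 0 := by exact_mod_cast V.tamagawaProduct_pos_holds.ne'
  have hcW0 : (W.tamagawaProduct : ℚ) ≠ 0 := by exact_mod_cast W.tamagawaProduct_pos_holds.ne'
  have hNV0 : (V.torsionOrder : ℚ) ≠ 0 := by exact_mod_cast (V.torsionOrder_pos V.finite_torsion_holds).ne'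
  have hNW0 : ((Nat.card W.toAffine.Point : ℕ) : ℚ) ≠ 0 := by exact_mod_cast Nat.card_pos.ne'
  have hNK0 : ((V.baseChange K).torsionOrder : ℚ) ≠ 0 := by
    exact_mod_cast ((V.baseChange K).torsionOrder_pos (V.baseChange K).finite_torsion_holds).ne'
  have hmq0 : (m : ℚ) ≠ 0 := by exact_mod_cast hm0
  have hua0 : |(C.u : ℚ)| ≠ 0 := abs_ne_zero.mpr C.u.ne_zero
  have hRHS0 : (m : ℚ) ^ 2 * ((V.baseChange ℝ).numRealComponents : ℚ) * |(C.u : ℚ)| * V.shaOrder * W.shaOrder *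
      V.tamagawaProduct * W.tamagawaProduct * ((V.baseChange K).torsionOrder : ℚ) ^ 2 ≠ 0 :=
    mul_ne_zero (mul_ne_zero (mul_ne_zero (mul_ne_zero (mul_ne_zero (mul_ne_zero (mul_ne_zero
      (pow_ne_zero 2 hmq0) hnV0) hua0) hSV0) hSW0) hcV0) hcW0) (pow_ne_zero 2 hNK0)
  have hM0 : (V.baseChange K).modifiedTamagawaProduct ≠ 0 := by
    intro hM
    rw [hM, mul_zero, zero_mul, zero_mul, zero_mul] at hcard
    exact hRHS0 hcard.symm
  refine ⟨hM0, ?_⟩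
  have hvmq : padicValRat p (m : ℚ) = 0 := by
    rw [padicValRat.of_int, padicValInt.eq_zero_of_not_dvd hmp]; simp
  have hv2 : padicValRat p (2 : ℚ) = 0 := by
    have h22 : ¬ p ∣ 2 := by
      intro hd
      have hle : p ≤ 2 := Nat.le_of_dvd two_pos hd
      exact hp (le_antisymm hle (Fact.out : p.Prime).two_le)
    rw [show (2 : ℚ) = ((2 : ℕ) : ℚ) by norm_num, padicValRat.of_nat]
    exact_mod_cast padicValNat.eq_zero_of_not_dvd h22
  have hvcard := congrArg (padicValRat p) hcard
  rw [padicValRat.mul (mul_ne_zero (mul_ne_zero (mul_ne_zero two_ne_zero hM0) hSK0) (pow_ne_zero 2 hNV0))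
      (pow_ne_zero 2 hNW0),
    padicValRat.mul (mul_ne_zero (mul_ne_zero two_ne_zero hM0) hSK0) (pow_ne_zero 2 hNV0),
    padicValRat.mul (mul_ne_zero two_ne_zero hM0) hSK0, padicValRat.mul two_ne_zero hM0,
    padicValRat.pow, padicValRat.pow,
    padicValRat.mul (mul_ne_zero (mul_ne_zero (mul_ne_zero (mul_ne_zero (mul_ne_zero (mul_ne_zero
      (pow_ne_zero 2 hmq0) hnV0) hua0) hSV0) hSW0) hcV0) hcW0) (pow_ne_zero 2 hNK0),
    padicValRat.mul (mul_ne_zero (mul_ne_zero (mul_ne_zero (mul_ne_zero (mul_ne_zero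
      (pow_ne_zero 2 hmq0) hnV0) hua0) hSV0) hSW0) hcV0) hcW0,
    padicValRat.mul (mul_ne_zero (mul_ne_zero (mul_ne_zero (mul_ne_zero
      (pow_ne_zero 2 hmq0) hnV0) hua0) hSV0) hSW0) hcV0,
    padicValRat.mul (mul_ne_zero (mul_ne_zero (mul_ne_zero (pow_ne_zero 2 hmq0) hnV0) hua0) hSV0) hSW0,
    padicValRat.mul (mul_ne_zero (mul_ne_zero (pow_ne_zero 2 hmq0) hnV0) hua0) hSV0,
    padicValRat.mul (mul_ne_zero (pow_ne_zero 2 hmq0) hnV0) hua0,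
    padicValRat.mul (pow_ne_zero 2 hmq0) hnV0, padicValRat.pow, padicValRat.pow, hvmq, hv2,
    padicValRat_numRealComponents_eq_zero V p hp,
    padicValRat.of_nat, padicValRat.of_nat, padicValRat.of_nat, padicValRat.of_nat,
    padicValRat.of_nat, padicValRat.of_nat, padicValRat.of_nat, padicValRat.of_nat] at hvcard
  push_cast at hvcard ⊢
  linarith

end MilneVal

end Summit.BirchSwinnertonDyer.Rank1Residual.Additive

end
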